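import Summits.QuantumFields.YangMills.Theorems.DiagonalMirrorRPRTwoShiftExtraction

/-!
# Crux `WeakCouplingHypercubicLimitRP` (stmt-QuantumFields-27398), door B, R1-side: the two-shift extraction over a
# COUNTABLE eigen-index (tsum editions of §1 of `…DiagonalMirrorRPRTwoShiftExtraction`)

Helper file (`--supports stmt-QuantumFields-27398 --as helper`) of hand `hand-10604-wilsonDiagModel-3` g0, docket director-ym g24
**O4 WORD 47 (1) item (iii)** (the sandwich side of the pinned two-shift probe, p-W1 of idea-crit-9 g13's verdict #119).

§1 of `…TwoShiftExtraction` (seat «spectral-transfer» g2, landed ✓p830218) proves the two-shift signal bound for a FINITE index type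
(`[Fintype ι]`, `sandwich ω x σ N d m = Σ_a Σ_b ω a b · x_b^{2m} · (σ_a x_a)^{N−2m−2d}`).  The eigen-package of the model of record
(`slicePkgAt r sch hβ k`, ✓`…WilsonDiagonalModelPinned`) is indexed by a COUNTABLY INFINITE Hilbert basis, and the two-insertion trace
formula that supplies the shifted sandwich (✓`Literature.Analysis.OperatorTheory.hasSum_integral_iterate_insert_two`, Simon *Trace Ideals*
Ch. 3) delivers a `HasSum` over `ι × ι`.  This file is the countable-index edition, stated DIRECTLY ON `HasSum` DATA (no new definition):

* `summable_twoShiftFamily` — the shifted-sandwich family `p ↦ ω p.1 p.2 · x_{p.2}^{2m} · (σ_{p.1} x_{p.1})^{N−2m−2d}` is summable as soon as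
  the two-index weights are (`Σ ω < ∞`, Hilbert–Schmidt), since every modulus is `≤ 1`;
* ★ `twoShift_signal_le_tsum` — if `HasSum (family at shift n) S₁`, `HasSum (family at shift 2n) S₂`, the off-top weight
  `Σ'_{p.1 ≠ o} ω p ≤ W`, every non-top modulus `≤ r`, and `HasSum (b ↦ ω o b (x_b^{2n} − x_b^{4n})) V` (the top row = the signal), then
  `V ≤ (S₁ − S₂) + 2 W r^{N−4n−2d}` (verbatim port of `twoShift_signal_le`: the second shift kills the vacuum entry, every other row is
  `≥ −2 ω r^{N−4n−2d}` termwise; `HasSum.add_compl` along the split `{p.1 ≠ o} ⊔ {p.1 = o}` and `hasSum_le`);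
* ★ `slowest_signal_le_tsum` — single slow mode `b`: `ω o b (x_b^{2n} − x_b^{4n}) ≤ (S₁ − S₂) + 2 W r^{N−4n−2d}` (`Summable.le_tsum` on the
  non-negative top row);
* `signal_shape_tsum` — the instantiation recipe for the `signal` field of `TwoShiftProbes` (two-sided clustering `|S₁ − μ| ≤ ε₁`,
  `|S₂ − μ| ≤ ε₂`, spare leg `N − 4n − 2d = p + 2n`): `ω o b (x_b^{2n} − x_b^{4n}) ≤ (ε₁ + ε₂) + 2 W x_b^{p} x_b^{2n}`.

Road taken (WORD 47 (1) «say which»): genuine `tsum`/`HasSum` statements under summability of the two-index weights — NO finite-rank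
truncation and no truncation error folded into `W`.

HONEST FRAMING: elementary real analysis on summable families; nothing about Wilson's measure, the letters K1/K2/R1/R2, D1′, the crux
⟨27398⟩, its heart S6i or the summit is proved here; the Yang–Mills mass gap is NOT proved here or anywhere in the tree.
No definition, no instance, no notation.
-/

open Filter Topology

namespace Summit.QuantumFields.YangMills.Cruxes.DiagonalMirrorRPR.SignTwistedDiagonalTrace

section Tsum

variable {ι : Type*}

/-- **Summability of the shifted-sandwich family** from summable non-negative two-index weights: every modulus factor is `≤ 1` in
absolute value. -/
theorem summable_twoShiftFamily (ω : ι → ι → ℝ) (x σ : ι → ℝ) (N d m : ℕ)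
    (hω : ∀ a b, 0 ≤ ω a b) (hx0 : ∀ a, 0 ≤ x a) (hx1 : ∀ a, x a ≤ 1) (hσ : ∀ a, σ a = 1 ∨ σ a = -1)
    (hωs : Summable fun p : ι × ι => ω p.1 p.2) :
    Summable fun p : ι × ι => ω p.1 p.2 * (x p.2 ^ (2 * m) * (σ p.1 * x p.1) ^ (N - 2 * m - 2 * d)) := by
  refine Summable.of_norm_bounded hωs fun p => ?_
  rw [Real.norm_eq_abs, abs_mul, abs_of_nonneg (hω _ _), abs_mul]
  have h1 : |x p.2 ^ (2 * m)| ≤ 1 := by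
    rw [abs_of_nonneg (pow_nonneg (hx0 _) _)]; exact pow_le_one₀ (hx0 _) (hx1 _)
  have h2 : |(σ p.1 * x p.1) ^ (N - 2 * m - 2 * d)| ≤ 1 :=
    (abs_signed_pow_le (hσ _) (hx0 _) _).trans (pow_le_one₀ (hx0 _) (hx1 _))
  calc ω p.1 p.2 * (|x p.2 ^ (2 * m)| * |(σ p.1 * x p.1) ^ (N - 2 * m - 2 * d)|) ≤ ω p.1 p.2 * (1 * 1) :=
        mul_le_mul_of_nonneg_left (mul_le_mul h1 h2 (abs_nonneg _) zero_le_one) (hω _ _)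
    _ = ω p.1 p.2 := by ring

/-- ★ **Two-shift signal bound, countable-index edition (top row).**  With non-negative summable two-index weights `ω`, moduli
`x ∈ [0,1]`, signs `σ = ±1`, the top index `o` (`x o = 1`, `σ o = 1`), `4n + 2d ≤ N`; `S₁, S₂` the sums of the shifted-sandwich family at
the shifts `n, 2n`; `W` a bound for the off-top weight `Σ'_{p.1 ≠ o} ω p`; `r ≥ 0` dominating every non-top modulus; and `V` the sum of the
top row `b ↦ ω o b (x_b^{2n} − x_b^{4n})` (the signal): `V ≤ (S₁ − S₂) + 2 W r^{N−4n−2d}`. -/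
theorem twoShift_signal_le_tsum (ω : ι → ι → ℝ) (x σ : ι → ℝ) (o : ι) (N d n : ℕ)
    (hω : ∀ a b, 0 ≤ ω a b) (hx0 : ∀ a, 0 ≤ x a) (hx1 : ∀ a, x a ≤ 1)
    (hσ : ∀ a, σ a = 1 ∨ σ a = -1) (hxo : x o = 1) (hσo : σ o = 1) (hN : 4 * n + 2 * d ≤ N)
    (hωs : Summable fun p : ι × ι => ω p.1 p.2) {S₁ S₂ : ℝ}
    (h₁ : HasSum (fun p : ι × ι => ω p.1 p.2 * (x p.2 ^ (2 * n) * (σ p.1 * x p.1) ^ (N - 2 * n - 2 * d))) S₁)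
    (h₂ : HasSum (fun p : ι × ι =>
      ω p.1 p.2 * (x p.2 ^ (2 * (2 * n)) * (σ p.1 * x p.1) ^ (N - 2 * (2 * n) - 2 * d))) S₂)
    {r W : ℝ} (hr0 : 0 ≤ r) (hr : ∀ a, a ≠ o → x a ≤ r)
    (hW : ∑' p : {p : ι × ι | p.1 ≠ o}, ω p.1.1 p.1.2 ≤ W) {V : ℝ}
    (hV : HasSum (fun b => ω o b * (x b ^ (2 * n) - x b ^ (4 * n))) V) :
    V ≤ (S₁ - S₂) + 2 * W * r ^ (N - 4 * n - 2 * d) := by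
  classical
  have hL2 : N - 2 * (2 * n) - 2 * d = N - 4 * n - 2 * d := by omega
  have hL : N - 4 * n - 2 * d ≤ N - 2 * n - 2 * d := by omega
  have h4 : 2 * (2 * n) = 4 * n := by ring
  rw [hL2, h4] at h₂
  -- the difference family and its sum
  have hF : HasSum (fun p : ι × ι => ω p.1 p.2 * (x p.2 ^ (2 * n) * (σ p.1 * x p.1) ^ (N - 2 * n - 2 * d) -
      x p.2 ^ (4 * n) * (σ p.1 * x p.1) ^ (N - 4 * n - 2 * d))) (S₁ - S₂) := by
    have e : (fun p : ι × ι => ω p.1 p.2 * (x p.2 ^ (2 * n) * (σ p.1 * x p.1) ^ (N - 2 * n - 2 * d) -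
        x p.2 ^ (4 * n) * (σ p.1 * x p.1) ^ (N - 4 * n - 2 * d))) =
        fun p : ι × ι => ω p.1 p.2 * (x p.2 ^ (2 * n) * (σ p.1 * x p.1) ^ (N - 2 * n - 2 * d)) -
          ω p.1 p.2 * (x p.2 ^ (4 * n) * (σ p.1 * x p.1) ^ (N - 4 * n - 2 * d)) := by
      funext p
      ring
    rw [e]
    exact h₁.sub h₂
  -- the termwise minorant: the top row itself, and `−2 ω r^{N−4n−2d}` off the top row
  set s : Set (ι × ι) := {p : ι × ι | p.1 ≠ o} with hs
  set G : ι × ι → ℝ := fun p => if p.1 = o then ω p.1 p.2 * (x p.2 ^ (2 * n) * (σ p.1 * x p.1) ^ (N - 2 * n - 2 * d) -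
      x p.2 ^ (4 * n) * (σ p.1 * x p.1) ^ (N - 4 * n - 2 * d)) else -(2 * r ^ (N - 4 * n - 2 * d) * ω p.1 p.2) with hG
  have hGF : ∀ p : ι × ι, G p ≤ ω p.1 p.2 * (x p.2 ^ (2 * n) * (σ p.1 * x p.1) ^ (N - 2 * n - 2 * d) -
      x p.2 ^ (4 * n) * (σ p.1 * x p.1) ^ (N - 4 * n - 2 * d)) := by
    intro p
    by_cases hp : p.1 = o
    · simp only [hG, if_pos hp, le_refl]
    · simp only [hG, if_neg hp]
      set u := (σ p.1 * x p.1) ^ (N - 2 * n - 2 * d) with hu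
      set v := (σ p.1 * x p.1) ^ (N - 4 * n - 2 * d) with hv
      set A := x p.1 ^ (N - 2 * n - 2 * d) with hA
      set B := x p.1 ^ (N - 4 * n - 2 * d) with hB
      set q₁ := x p.2 ^ (2 * n) with hq₁
      set q₂ := x p.2 ^ (4 * n) with hq₂
      have huA : |u| ≤ A := abs_signed_pow_le (hσ p.1) (hx0 p.1) _
      have hvB : |v| ≤ B := abs_signed_pow_le (hσ p.1) (hx0 p.1) _
      have hAB : A ≤ B := pow_le_pow_of_le_one (hx0 p.1) (hx1 p.1) hL
      have hA0 : 0 ≤ A := pow_nonneg (hx0 p.1) _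
      have hB0 : 0 ≤ B := pow_nonneg (hx0 p.1) _
      have hBr : B ≤ r ^ (N - 4 * n - 2 * d) := pow_le_pow_left₀ (hx0 p.1) (hr p.1 hp) _
      have hq₁0 : 0 ≤ q₁ := pow_nonneg (hx0 p.2) _
      have hq₁1 : q₁ ≤ 1 := pow_le_one₀ (hx0 p.2) (hx1 p.2)
      have hq₂0 : 0 ≤ q₂ := pow_nonneg (hx0 p.2) _
      have hq₂1 : q₂ ≤ 1 := pow_le_one₀ (hx0 p.2) (hx1 p.2)
      have hu' : -A ≤ u := (abs_le.1 huA).1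
      have hv' : v ≤ B := (abs_le.1 hvB).2
      have e1 : -A ≤ q₁ * u := by nlinarith [mul_nonneg hq₁0 (by linarith : 0 ≤ u + A)]
      have e2 : q₂ * v ≤ B := by nlinarith [mul_nonneg hq₂0 (by linarith : 0 ≤ B - v)]
      have e3 : -(2 * r ^ (N - 4 * n - 2 * d)) ≤ q₁ * u - q₂ * v := by linarith
      have := mul_le_mul_of_nonneg_left e3 (hω p.1 p.2)
      linarith
  -- the minorant's sum: off the top row …
  have ha : HasSum (G ∘ (↑) : s → ℝ) (-(2 * r ^ (N - 4 * n - 2 * d)) * ∑' p : s, ω p.1.1 p.1.2) := by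
    have h1 : (G ∘ (↑) : s → ℝ) = fun p : s => -(2 * r ^ (N - 4 * n - 2 * d)) * ω p.1.1 p.1.2 := by
      funext p
      have hp : (p : ι × ι).1 ≠ o := p.2
      simp only [Function.comp, hG, if_neg hp]
      ring
    rw [h1]
    exact ((hωs.subtype _).hasSum).mul_left _
  -- … and on the top row, transported from `hV` along `b ↦ (o, b)`
  have hb : HasSum (G ∘ (↑) : (sᶜ : Set (ι × ι)) → ℝ) V := by
    let e : ι ≃ (sᶜ : Set (ι × ι)) :=
      { toFun := fun b => ⟨(o, b), by simp [hs]⟩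
        invFun := fun p => (p : ι × ι).2
        left_inv := fun b => rfl
        right_inv := fun p => by
          have hp : (p : ι × ι).1 = o := by
            have := p.2; simp only [hs, Set.mem_compl_iff, Set.mem_setOf_eq, not_not] at this; exact this
          exact Subtype.ext (Prod.ext hp.symm rfl) }
    rw [← e.hasSum_iff]
    convert hV using 1
    funext b
    simp only [Function.comp, hG, e, Equiv.coe_fn_mk, if_pos rfl, hxo, hσo, mul_one, one_pow]
  have hle : -(2 * r ^ (N - 4 * n - 2 * d)) * (∑' p : s, ω p.1.1 p.1.2) + V ≤ S₁ - S₂ :=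
    hasSum_le hGF (ha.add_compl hb) hF
  have hsω : 0 ≤ ∑' p : s, ω p.1.1 p.1.2 := tsum_nonneg fun p => hω _ _
  have hrp : 0 ≤ r ^ (N - 4 * n - 2 * d) := pow_nonneg hr0 _
  have := mul_le_mul_of_nonneg_left hW hrp
  nlinarith

/-- ★ **Slowest-first form, countable-index edition.**  For a single non-top mode `b`, with `r` dominating every non-top modulus and `W`
the off-top weight: `ω(o,b) (x_b^{2n} − x_b^{4n}) ≤ (S₁ − S₂) + 2 W r^{N−4n−2d}`. -/
theorem slowest_signal_le_tsum (ω : ι → ι → ℝ) (x σ : ι → ℝ) (o : ι) (N d n : ℕ)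
    (hω : ∀ a b, 0 ≤ ω a b) (hx0 : ∀ a, 0 ≤ x a) (hx1 : ∀ a, x a ≤ 1)
    (hσ : ∀ a, σ a = 1 ∨ σ a = -1) (hxo : x o = 1) (hσo : σ o = 1) (hN : 4 * n + 2 * d ≤ N)
    (hωs : Summable fun p : ι × ι => ω p.1 p.2) {S₁ S₂ : ℝ}
    (h₁ : HasSum (fun p : ι × ι => ω p.1 p.2 * (x p.2 ^ (2 * n) * (σ p.1 * x p.1) ^ (N - 2 * n - 2 * d))) S₁)
    (h₂ : HasSum (fun p : ι × ι =>
      ω p.1 p.2 * (x p.2 ^ (2 * (2 * n)) * (σ p.1 * x p.1) ^ (N - 2 * (2 * n) - 2 * d))) S₂)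
    (b : ι) {r W : ℝ} (hr0 : 0 ≤ r) (hr : ∀ a, a ≠ o → x a ≤ r)
    (hW : ∑' p : {p : ι × ι | p.1 ≠ o}, ω p.1.1 p.1.2 ≤ W) :
    ω o b * (x b ^ (2 * n) - x b ^ (4 * n)) ≤ (S₁ - S₂) + 2 * W * r ^ (N - 4 * n - 2 * d) := by
  have hterm0 : ∀ c, 0 ≤ ω o c * (x c ^ (2 * n) - x c ^ (4 * n)) := fun c =>
    mul_nonneg (hω o c) (sub_nonneg.2 (pow_le_pow_of_le_one (hx0 c) (hx1 c) (by omega)))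
  have hrow : Summable fun c => ω o c * (x c ^ (2 * n) - x c ^ (4 * n)) := by
    have hωo : Summable fun c => ω o c := hωs.prod_factor o
    refine Summable.of_norm_bounded hωo fun c => ?_
    rw [Real.norm_eq_abs, abs_of_nonneg (hterm0 c)]
    have h1 : x c ^ (2 * n) - x c ^ (4 * n) ≤ 1 := by
      linarith [pow_le_one₀ (n := 2 * n) (hx0 c) (hx1 c), pow_nonneg (hx0 c) (4 * n)]
    exact mul_le_of_le_one_right (hω o c) h1
  have hmain := twoShift_signal_le_tsum ω x σ o N d n hω hx0 hx1 hσ hxo hσo hN hωs h₁ h₂ hr0 hr hW hrow.hasSum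
  have hsingle : ω o b * (x b ^ (2 * n) - x b ^ (4 * n)) ≤ ∑' c, ω o c * (x c ^ (2 * n) - x c ^ (4 * n)) :=
    hrow.le_tsum b fun c _ => hterm0 c
  linarith

/-- **Instantiation recipe for the `signal` field of `TwoShiftProbes`, countable-index edition.**  With a two-sided clustering bound at
the shifts `n, 2n` around a common centre `μ` and the spare-leg bookkeeping `N − 4n − 2d = p + 2n`, the slowest mode `b` obeys exactly
the field's inequality `ω(o,b)(x_b^{2n} − x_b^{4n}) ≤ (ε₁ + ε₂) + 2 W x_b^{p} x_b^{2n}`. -/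
theorem signal_shape_tsum (ω : ι → ι → ℝ) (x σ : ι → ℝ) (o : ι) (N d n p : ℕ)
    (hω : ∀ a b, 0 ≤ ω a b) (hx0 : ∀ a, 0 ≤ x a) (hx1 : ∀ a, x a ≤ 1)
    (hσ : ∀ a, σ a = 1 ∨ σ a = -1) (hxo : x o = 1) (hσo : σ o = 1) (hNp : N - 4 * n - 2 * d = p + 2 * n)
    (hN : 4 * n + 2 * d ≤ N) (hωs : Summable fun p : ι × ι => ω p.1 p.2) {S₁ S₂ : ℝ}
    (h₁ : HasSum (fun p : ι × ι => ω p.1 p.2 * (x p.2 ^ (2 * n) * (σ p.1 * x p.1) ^ (N - 2 * n - 2 * d))) S₁)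
    (h₂ : HasSum (fun p : ι × ι =>
      ω p.1 p.2 * (x p.2 ^ (2 * (2 * n)) * (σ p.1 * x p.1) ^ (N - 2 * (2 * n) - 2 * d))) S₂)
    (b : ι) {W μ ε₁ ε₂ : ℝ} (hr : ∀ a, a ≠ o → x a ≤ x b)
    (hW : ∑' p : {p : ι × ι | p.1 ≠ o}, ω p.1.1 p.1.2 ≤ W)
    (h₁μ : |S₁ - μ| ≤ ε₁) (h₂μ : |S₂ - μ| ≤ ε₂) :
    ω o b * (x b ^ (2 * n) - x b ^ (4 * n)) ≤ (ε₁ + ε₂) + 2 * W * x b ^ p * x b ^ (2 * n) := by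
  have h := slowest_signal_le_tsum ω x σ o N d n hω hx0 hx1 hσ hxo hσo hN hωs h₁ h₂ b (hx0 b) hr hW
  rw [hNp, pow_add] at h
  have hd : S₁ - S₂ ≤ ε₁ + ε₂ := by
    have := abs_le.1 h₁μ; have := abs_le.1 h₂μ; linarith
  linarith

end Tsum

end Summit.QuantumFields.YangMills.Cruxes.DiagonalMirrorRPR.SignTwistedDiagonalTrace
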